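/-
COR-CM (cell pub-hodgecm2, stage 2 of the Hodge ladder) — Δ2 BRIDGE, X1 (J) pin, piece **(J2) «ALBANESE ON COMPONENTS»**, the
HOLE-FREE half of the PIN: Liu's compactified Shimura variety `X_K = S̃h(𝕍)_K` of a §4.2 datum `C` ([Liu2021] §4.2 l. 2062, Def. C.8),
base-changed to `ℂ` along the pin embedding, IS A FINITE COPRODUCT OF THE TREE'S PICARD MODULAR SURFACES `P_Γ(V)` — the cofan
`inj c : P_{Γ_c}(V) ⟶ X_K ⊗_{E,e ι₁} ℂ` on which `CorCM/D2Bridge/AlbaneseOnPieceCore.lean` is applied piece by piece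
(`albOnPiece (C.alb K) (inj c) y`).  This is TEAM hComp's `hUnif` ([Deligne 1979] §2.1.2 canonical-model pieces) composed with the
model match (`Model.hTree_of_hUnif_along`, `HComp/TreeCofanOfUnif.lean`) and transported from Liu's Prop.-C.5 slot to `X_K ⊗ ℂ`
(Compact Case `X_K = Sh(𝕍)_K`, Prop. C.5 at `τ' = e ι₁`) — EXACTLY the transport inside pin-1's ∕ hcomp-abcm-1's
`Model.hCompEpi_of_unif_of_albEpi_along` (`HComp/PinReachEpi.lean` §3), here EXPOSED AS A NAMED COFAN so the (J2) pin can read it.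
Provisional fifth hand own-crow g92 (prover-pub-hodgecm-own-crow-g92-0) for the SEAT ASK d2bridge-prove-5 (pub-hodgecm2 OPS-REQUESTS
l. 377).  THEOREMS ONLY; imports `CorCM/HComp` + Literature (no `HodgeCM.Model.*`, no manifest path); nothing landed is edited or
restated.  FRAMING: HC_CM is NOT proved; «Δ2 BRIDGE CLOSED» is NOT claimed; the tower INDEXING of the pieces (`Ξ_K ↔ h`,
`HComp.Λ ↔ Γ.conj`) is Model cone and NOT here.
-/
import Summits.HodgeConjecture.CorCM.B01.Transposition.HComp.TreeCofanOfUnif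
import Summits.HodgeConjecture.CorCM.B01.Transposition.HComp.HUnifHolds
import Summits.HodgeConjecture.CorCM.B01.Transposition.HComp.Sec42DataOf
import Literature.AlgebraicGeometry.Motives.FiberBaseChange
import HarnessLib

/-!
# Δ2 bridge, (J2): `X_K ⊗_{E,e ι₁} ℂ` is a finite coproduct of the tree's Picard modular surfaces `P_Γ(V)`

[Liu2021] Y. Liu, arXiv:2102.11518 = Camb. J. Math. 9 (2021), §4.2 l. 2060–2066: «Every scheme `Sh(𝕍)_K` is smooth,
quasi-projective, and of dimension `n − 1` over `E`; it is projective if and only if we are in the Compact Case. […] Put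
`X_K := S̃h(𝕍)_K` […]»; App. C l. 4656 «If `Sh(𝕍)_K` is proper, then `S̃h(𝕍)_K = Sh(𝕍)_K`»; Prop. C.5 (l. 4627–4633):
`{Sh(𝕍)_K ⊗_{E,τ'} τ'(E)}_K ≃ {Sh(G(τ), h_{V(τ),τ'})_K}_K`.  [Deligne1979] §2.1.2: the complex points of a Shimura variety at level `K`
are the disjoint sum of the `Γ_g \ X⁺`.

* `exists_treeCofan_X_baseChange_along` — for any pin embedding family `e`, any Prop.-C.5 datum `P5`, ANY §4.2 datum `C` over it, and
  the binder `hUnif` (TEAM hComp, `Model.hComp_of_unif_of_alb_along`) VERBATIM: per Galois CM face `F` (`6 ≤ [F:ℚ]`), below some open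
  compact `Ksm`, for every sufficiently small `K ≤ Ksm`: finitely many levels `Γ_c : Level V` and a COLIMIT COFAN
  `inj c : P_{Γ_c}(V) ⟶ X_K ⊗_{E,e ι₁} ℂ` (`P_Γ(V) = Var.scheme (ballQuotientUniformisedDatum_of h₁) h₃ (.pms (pmsCode F ι₁ V Γ))`).
  KERNEL = `Model.hTree_of_hUnif_along` (pieces ARE tree surfaces: Mumford AG I (4.15) via `UnitaryBallModelUnique.exists_iso_of_eq`)
  + the transport of `Model.hCompEpi_of_unif_of_albEpi_along` (real place `τ` under `e ι₁`; Compact Case `d = [F⁺:ℚ] > 1` so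
  `j : Sh(𝕍)_K ⥲ X_K`; Prop. C.5's isomorphism at `τ' = e ι₁`; `baseChangeHomObjIsoOfComp`), token for token.
* `exists_treeCofan_X_baseChange_conj` — CLOSED at the honest datum: `e ι₁ := conj ∘ ι₁`, `P5 := Model.honestP5Of h`,
  `hUnif := Model.hUnif_holds h` ([Deligne 1979] 2.2.5 + Cor. 2.7.21 behind `h : exists_recordSystem`), for ANY `C` over it — in
  particular Liu's own `C := Model.sec42DataOf h iso` (`exists_treeCofan_X_baseChange_sec42DataOf`).
* `geometricallyIrreducible_pms` — the pieces are geometrically irreducible (so `albOnPiece (C.alb K) (inj c) y` of the core applies),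
  and `nonempty_algPoints_pms` — they have complex points (base points `y`).

Remaining for the PIN (Model cone, after the port hole closes): index the pieces by the tower's `h` (`Ξ_K`, `HComp.Λ V K hK (g q) =
Γ_K.conj h`) and compose `albOnComponent K h := inj h ≫`-side with the core's `albOnPiece`.  HC_CM is NOT proved.

## References
* [Liu2021] Y. Liu, arXiv:2102.11518: §4.2 l. 2060–2066, App. C Prop. C.5 (l. 4627–4633), l. 4656, Def. C.8 (l. 4663–4665).
* [Deligne1979ShimuraVarieties] P. Deligne, *Variétés de Shimura*, Corvallis 1979, §2.1.2, 2.2.5, Cor. 2.7.21.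
* [Mumford1981] D. Mumford, *Algebraic Geometry I*, §4B (4.15).
* [GortzWedhorn2020] U. Görtz, T. Wedhorn, *Algebraic Geometry I*, Prop. 4.16 (transitivity of base change), Thm. 14.72 (1).
-/

set_option autoImplicit false

noncomputable section

open CategoryTheory CategoryTheory.Limits AlgebraicGeometry NumberField
open Literature.AlgebraicGeometry.Motives
open Literature.AlgebraicGeometry.HodgeTheory
open Literature.AlgebraicGeometry.ShimuraVarieties
open Literature.AlgebraicGeometry.ShimuraVarieties.UnitaryCanonicalModel
open Literature.NumberTheory.Automorphic
open Literature.NumberTheory.Automorphic.PicardCM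
open Literature.NumberTheory.Automorphic.Liu2021
open Literature.NumberTheory.Automorphic.Liu2021.AppendixC
open Summit.HodgeConjecture.CorCM.Model

namespace Summit.HodgeConjecture.CorCM.D2Bridge

/-! ## §1 The pieces `P_Γ(V)` are geometrically irreducible and have complex points -/

/-- The realised Picard modular surface `P_Γ(V)` (`Var.scheme _ _ (.pms _)`, smooth projective of dimension 2, `Var.isSmoothProjective`)
is geometrically irreducible — the instance the (J2) core `albOnPiece` asks of a piece. [folklore] -/
theorem geometricallyIrreducible_pms (hU : BallQuotientUniformisedDatum) (h₃ : CMAbelianVarietyRealised) (c : PicardCode) :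
    GeometricallyIrreducible (Var.scheme hU h₃ (.pms c)).hom :=
  (Var.isSmoothProjective hU h₃ (.pms c)).geometricallyIrreducible

/-- `P_Γ(V)` has a complex point (Nullstellensatz, `IsSmoothProjective.nonempty_algPoints`) — a base point `y` for `albOnPiece`.
[folklore] -/
theorem nonempty_algPoints_pms (hU : BallQuotientUniformisedDatum) (h₃ : CMAbelianVarietyRealised) (c : PicardCode) :
    Nonempty (AlgPoints (Var.scheme hU h₃ (.pms c)) ℂ) :=
  (Var.isSmoothProjective hU h₃ (.pms c)).nonempty_algPoints ℂ

/-! ## §2 `X_K ⊗_{E,e ι₁} ℂ = ∐_c P_{Γ_c}(V)` from `hUnif`, along any pin embedding -/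

/-- **`X_K ⊗_{E,e ι₁} ℂ` is a finite coproduct of tree surfaces `P_{Γ_c}(V)`, from `hUnif` along `e ι₁`.**  For ANY §4.2 datum `C`
over a Prop.-C.5 datum `P5` and TEAM hComp's binder `hUnif` VERBATIM (`Model.hComp_of_unif_of_alb_along`, `Item6PinReachAlong.lean`
:158–169): per Galois CM face `F` with `6 ≤ [F:ℚ]`, an open compact `Ksm ≤ 𝔾(𝔸_F^∞)` such that for every sufficiently small `K` with
`K ≤ Ksm` there are finitely many levels `Γ_c : Level V` and a colimit cofan `inj c : P_{Γ_c}(V) ⟶ X_K ⊗_{E,e ι₁} ℂ`.  KERNEL (token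
for token the transport of `Model.hCompEpi_of_unif_of_albEpi_along`, §3 of `HComp/PinReachEpi.lean`, preceded by the model match
`Model.hTree_of_hUnif_along`): the real place `τ` of `F⁺` under `e ι₁`; `hTree` at `K`; Compact Case (`d = [F⁺:ℚ] > 1`, so `Sh(𝕍)_K` is
projective, hence proper, and `j : Sh(𝕍)_K ⟶ X_K` is an isomorphism, App. C l. 4656); Prop. C.5's isomorphism at `τ' = e ι₁`
transported along `e ι₁ = (e ι₁)(E) ↪ ℂ ∘ e ι₁` (`baseChangeHomObjIsoOfComp`); the cofan moved along the resulting isomorphism.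
HC_CM is NOT proved; `hUnif` is not inhabited here.
[cite: Liu2021, §4.2 (FJcycle.tex l. 2060–2066), App. C Prop. C.5 (l. 4627–4633) and l. 4656] [cite: Deligne1979ShimuraVarieties, §2.1.2]
[cite: Mumford1981, §4B (4.15) Corollary, p. 67] -/
theorem exists_treeCofan_X_baseChange_along
    (h₁ : BallQuotientUniformised) (h₃ : CMAbelianVarietyRealised)
    (e : ∀ (F : CMField), (F →+* ℂ) → (F →+* ℂ))
    (P5 : ∀ (F : CMField) (ι₁ : F →+* ℂ) (_ : HermSpace3 F ι₁) (_ : CMType F), PropC5Data (maximalRealSubfield F) F)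
    (iso : ∀ (F : CMField) (ι₁ : F →+* ℂ) (_ : HermSpace3 F ι₁) (_ : CMType F), ℕ → Prop)
    (C : ∀ (F : CMField) (ι₁ : F →+* ℂ) (V : HermSpace3 F ι₁) (Φ : CMType F), Sec42Data (P5 F ι₁ V Φ) (iso F ι₁ V Φ))
    (hUnif : ∀ (F : CMField), IsGalois ℚ F → 6 ≤ Module.finrank ℚ F → ∀ (Φ : CMType F) (ι₁ : F →+* ℂ), ι₁ ∈ Φ.1 →
      ∀ (V : HermSpace3 F ι₁) (τ : maximalRealSubfield F →+* ℝ), C5.IsAbove τ (e F ι₁) →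
        ∃ Ksm : Subgroup (P5 F ι₁ V Φ).G, IsOpenCompact Ksm ∧
          ∀ K : C5.OpenCompactSubgroup (P5 F ι₁ V Φ).G, K.1 ≤ Ksm →
            ∃ (Cset : Type) (_ : Fintype Cset) (X : Cset → SchemeOver ℂ) (B : ∀ c, UnitaryBallUniformisationDatum 2 (X c))
              (Γ : Cset → Level V)
              (inj : ∀ c, X c ⟶ (baseChangeHom (e F ι₁).fieldRange.subtype).obj
                (((P5 F ι₁ V Φ).Sh τ (e F ι₁)).obj (C5.OpenCompactSubgroup.transport ((P5 F ι₁ V Φ).fix τ) K))),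
              (∀ c, (B c).Hℂ = V.Hm.map ι₁) ∧
              (∀ c, (B c).Γ.map (Matrix.GeneralLinearGroup.map (B c).τ₁) =
                (Γ c).Γ.map (Matrix.GeneralLinearGroup.map ι₁)) ∧
              Nonempty (IsColimit (Cofan.mk _ inj))) :
    ∀ (F : CMField), IsGalois ℚ F → 6 ≤ Module.finrank ℚ F → ∀ (Φ : CMType F) (ι₁ : F →+* ℂ), ι₁ ∈ Φ.1 →
      ∀ V : HermSpace3 F ι₁, ∃ Ksm : Subgroup (C F ι₁ V Φ).G, IsOpenCompact Ksm ∧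
        ∀ K : C5.SmallLevel (C F ι₁ V Φ).S.K₀, (K.1 : Subgroup (C F ι₁ V Φ).G) ≤ Ksm →
          ∃ (Cset : Type) (_ : Fintype Cset) (Γ : Cset → Level V)
            (inj : ∀ c, Var.scheme (ballQuotientUniformisedDatum_of h₁) h₃ (.pms (pmsCode F ι₁ V (Γ c))) ⟶
              (baseChangeHom (e F ι₁)).obj ((C F ι₁ V Φ).X K)),
            Nonempty (IsColimit (Cofan.mk _ inj)) := by
  intro F hG h6 Φ ι₁ hι V
  -- the real embedding `τ` of `F⁺ = maximalRealSubfield F` under `e ι₁`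
  have hreal : ComplexEmbedding.IsReal ((e F ι₁).comp (algebraMap (maximalRealSubfield F) F)) := by
    rw [ComplexEmbedding.isReal_iff]
    ext x
    rw [ComplexEmbedding.conjugate_coe_eq]
    exact (mem_maximalRealSubfield_iff (x : F)).1 x.2 (e F ι₁)
  set τ : maximalRealSubfield F →+* ℝ := hreal.embedding
  have hτ : C5.IsAbove τ (e F ι₁) := by
    ext x
    simp [τ, ComplexEmbedding.IsReal.coe_embedding_apply]
  -- `hTree` (pieces ARE tree surfaces) below `Ksm`
  obtain ⟨Ksm, hKsm, htree⟩ := hTree_of_hUnif_along h₁ h₃ e P5 hUnif F hG h6 Φ ι₁ hι V τ hτ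
  refine ⟨Ksm, hKsm, fun K hK => ?_⟩
  obtain ⟨Cset, _, Γ, inj, ⟨hcol⟩⟩ := htree K.1 hK
  -- `d = [F⁺ : ℚ] > 1`: the Compact Case, `Sh(𝕍)_K` projective hence proper, `X_K = Sh(𝕍)_K`
  have hd : 1 < Module.finrank ℚ (maximalRealSubfield F) := by
    have hmul := Module.finrank_mul_finrank ℚ (maximalRealSubfield F) F
    rw [Algebra.IsQuadraticExtension.finrank_eq_two (maximalRealSubfield F) F] at hmul
    omega
  have hproj : IsProjectiveOver ((C F ι₁ V Φ).S.Sh𝕍.obj K) := (C F ι₁ V Φ).cpt.projective_Sh_of (Or.inl hd) K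
  haveI : IsProper ((C F ι₁ V Φ).S.Sh𝕍.obj K).hom := hproj.isProper
  haveI : IsIso ((C F ι₁ V Φ).cpt.j.app K) := (C F ι₁ V Φ).cpt.isIso_j_of_isProper K inferInstance
  -- `X_K ⊗_{E,e ι₁} ℂ ≅ Sh(G(τ), h_{V(τ),e ι₁})_{fix τ K} ⊗ ℂ`
  have hcomp : ((e F ι₁).fieldRange.subtype).comp (e F ι₁).rangeRestrictField = e F ι₁ := RingHom.ext fun _ => rfl
  let eX : (baseChangeHom (e F ι₁)).obj ((C F ι₁ V Φ).X K) ≅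
      (baseChangeHom (e F ι₁).fieldRange.subtype).obj
        (((P5 F ι₁ V Φ).Sh τ (e F ι₁)).obj (C5.OpenCompactSubgroup.transport ((P5 F ι₁ V Φ).fix τ) K.1)) :=
    ((baseChangeHom (e F ι₁)).mapIso (asIso ((C F ι₁ V Φ).cpt.j.app K))).symm ≪≫
      (baseChangeHomObjIsoOfComp (e F ι₁).rangeRestrictField (e F ι₁).fieldRange.subtype (e F ι₁) hcomp
        ((C F ι₁ V Φ).S.Sh𝕍.obj K)).symm ≪≫
      (baseChangeHom (e F ι₁).fieldRange.subtype).mapIso (((C F ι₁ V Φ).S.iso τ (e F ι₁) hτ).app K)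
  -- transport the coproduct decomposition to `X_K ⊗ ℂ`
  exact ⟨Cset, inferInstance, Γ, fun c => inj c ≫ eX.inv, ⟨hcol.ofIsoColimit (Cofan.ext eX.symm (fun c => rfl))⟩⟩

/-! ## §3 CLOSED at the honest datum: `e ι₁ := conj ∘ ι₁`, `P5 := Model.honestP5Of h`, `hUnif := Model.hUnif_holds h` -/

/-- **`X_K ⊗_{E,ῑ₁} ℂ` is a finite coproduct of tree surfaces, at the honest datum** — `exists_treeCofan_X_baseChange_along` at
`e := conj ∘ ·`, `P5 := Model.honestP5Of h`, fed with pin-1's THEOREM `Model.hUnif_holds h` ([Deligne 1979] 2.2.5 + Cor. 2.7.21 behind the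
record `h : exists_recordSystem`), for ANY §4.2 datum `C` over the honest datum.  Remaining cite: `exists_recordSystem` only; the
universe records `h₁`, `h₃` as everywhere in the reach chain.  HC_CM is NOT proved.
[cite: Deligne1979ShimuraVarieties, §2.1.2, 2.2.5 and Cor. 2.7.21] [cite: Liu2021, App. C Prop. C.5 (FJcycle.tex l. 4627–4633), §4.2 l. 2060–2066] -/
theorem exists_treeCofan_X_baseChange_conj (h : exists_recordSystem)
    (h₁ : BallQuotientUniformised) (h₃ : CMAbelianVarietyRealised)
    (iso : ∀ (F : CMField) (ι₁ : F →+* ℂ) (_ : HermSpace3 F ι₁) (_ : CMType F), ℕ → Prop)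
    (C : ∀ (F : CMField) (ι₁ : F →+* ℂ) (V : HermSpace3 F ι₁) (Φ : CMType F), Sec42Data (honestP5Of h F ι₁ V Φ) (iso F ι₁ V Φ)) :
    ∀ (F : CMField), IsGalois ℚ F → 6 ≤ Module.finrank ℚ F → ∀ (Φ : CMType F) (ι₁ : F →+* ℂ), ι₁ ∈ Φ.1 →
      ∀ V : HermSpace3 F ι₁, ∃ Ksm : Subgroup (C F ι₁ V Φ).G, IsOpenCompact Ksm ∧
        ∀ K : C5.SmallLevel (C F ι₁ V Φ).S.K₀, (K.1 : Subgroup (C F ι₁ V Φ).G) ≤ Ksm →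
          ∃ (Cset : Type) (_ : Fintype Cset) (Γ : Cset → Level V)
            (inj : ∀ c, Var.scheme (ballQuotientUniformisedDatum_of h₁) h₃ (.pms (pmsCode F ι₁ V (Γ c))) ⟶
              (baseChangeHom ((starRingEnd ℂ).comp ι₁)).obj ((C F ι₁ V Φ).X K)),
            Nonempty (IsColimit (Cofan.mk _ inj)) :=
  exists_treeCofan_X_baseChange_along h₁ h₃ (fun _ ι₁ => (starRingEnd ℂ).comp ι₁) (honestP5Of h) iso C (hUnif_holds h)

/-- **… in particular for Liu's OWN §4.2 datum `C := Model.sec42DataOf h iso`** (`HComp/Sec42DataOf.lean`: Prop. C.5's system = the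
canonical-model record, Def. C.8 = `compactifiedOf`, `A_K := Alb_{X_K}` chosen inside the cited existence theorem): its `X_K ⊗_{E,ῑ₁} ℂ`
is a finite coproduct of tree surfaces `P_{Γ_c}(V)`, level by level below `Ksm`.  HC_CM is NOT proved.
[cite: Deligne1979ShimuraVarieties, §2.1.2, 2.2.5 and Cor. 2.7.21] [cite: Liu2021, §4.2 l. 2053–2074 and App. C Prop. C.5] -/
theorem exists_treeCofan_X_baseChange_sec42DataOf (h : exists_recordSystem)
    (h₁ : BallQuotientUniformised) (h₃ : CMAbelianVarietyRealised)
    (iso : ∀ (F : CMField) (ι₁ : F →+* ℂ) (_ : HermSpace3 F ι₁) (_ : CMType F), ℕ → Prop) :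
    ∀ (F : CMField), IsGalois ℚ F → 6 ≤ Module.finrank ℚ F → ∀ (Φ : CMType F) (ι₁ : F →+* ℂ), ι₁ ∈ Φ.1 →
      ∀ V : HermSpace3 F ι₁, ∃ Ksm : Subgroup (sec42DataOf h iso F ι₁ V Φ).G, IsOpenCompact Ksm ∧
        ∀ K : C5.SmallLevel (sec42DataOf h iso F ι₁ V Φ).S.K₀, (K.1 : Subgroup (sec42DataOf h iso F ι₁ V Φ).G) ≤ Ksm →
          ∃ (Cset : Type) (_ : Fintype Cset) (Γ : Cset → Level V)
            (inj : ∀ c, Var.scheme (ballQuotientUniformisedDatum_of h₁) h₃ (.pms (pmsCode F ι₁ V (Γ c))) ⟶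
              (baseChangeHom ((starRingEnd ℂ).comp ι₁)).obj ((sec42DataOf h iso F ι₁ V Φ).X K)),
            Nonempty (IsColimit (Cofan.mk _ inj)) :=
  exists_treeCofan_X_baseChange_conj h h₁ h₃ iso (sec42DataOf h iso)

end Summit.HodgeConjecture.CorCM.D2Bridge

end
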